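import Summits.NavierStokesRegularity.NavierStokesRegularity.Theorems.SqueezeCycleExtremalBiaxialitySubcriticalPayerTomographyFarShellBound
import HarnessLib

/-!
# Route `SqueezeCycle`, crux `ExtremalBiaxialitySubcritical` — the polar-quadrupole tomography of
# the pressure Hessian for bounded smooth fields (line `oseen-shell-polar-tomography`,
# stub `stub_payerTomography`), IV

Helper file for item `stmt-NavierStokesRegularity-11609`
(`Summit.NavierStokesRegularity.NavierStokesRegularity.Theses.SqueezeCycle.ExtremalBiaxialitySubcritical`).

Main result `exists_hessian_tomography_bound`: there is an absolute constant `c₀` such that for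
every divergence-free `u ∈ C⁴(ℝ³; ℝ³)` with `|u| ≤ M`, `‖∇u‖ ≤ M₁` and `G = div((u·∇)u) = tr(∇u)²`
bounded with bounded gradient, every `q ∈ C⁴(ℝ³)` with `Δq = −G` and `‖∇q‖ ≤ B`, every `R > 0`,
`x` and unit `e`,

  `|D²q(x)(e,e) + G(x)/3 + ∫_{|z|<R} D²Γ(z)(e,e) (G(x − z) − G(x)) dz| ≤ c₀ (M M₁/R + M²/R² + B/R)`,

`Γ = −1/(4π|z|)`, `D²Γ(z)(e,e) = −(3⟨z,e⟩² − |z|²)/(4π|z|⁵)`. Ingredients: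
* `exists_farShell_bound` (file III) — the far-shell bound;
* `fderiv2_apply_eq_newton_green` — the localised Green identity `∫Γ₀Δφ = φ(0) − ∫λφ`
  (`integral_newtonNear_mul_laplacian`) for `φ = ∂ₑ∂ₑq(x − ·)`:
  `D²q(x)(e,e) = ∫Γ₀ ∂ₑ∂ₑΔq(x−z) dz + ∫ ∂ₑλ(z) ∂ₑq(x−z) dz`, the last term `O(B/R)`;
* the Gilbarg–Trudinger formula `∫Γ₀ ∂ₑ∂ₑG(x−z) = ∫ D²Γ₀(e,e)(G(x−z) − G(x))` (file I) and the
  trace term `∫_{B̄_R} D²Γ∞(e,e) = 1/3` (`setIntegral_fderiv2_newtonFar_apply_self`) on the sharp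
  ball, where `D²Γ = D²Γ₀ + D²Γ∞`.

Sources: D. Gilbarg, N. S. Trudinger, *Elliptic PDE of Second Order* (2001), (2.17), Lemma 4.2
with (4.9)–(4.10) [GilbargTrudinger2001]; the rest is folklore.
-/

noncomputable section

open MeasureTheory Set Filter Metric Topology InnerProductSpace Function Real
open scoped RealInnerProductSpace Laplacian ContDiff ENNReal NNReal

namespace Summit.NavierStokesRegularity.NavierStokesRegularity.Theorems

open Literature.Analysis Literature.Analysis.FluidPDE

set_option linter.dupNamespace false

-- nested operator types `ℝ³ →L[ℝ] ℝ³ →L[ℝ] ℝ³ →L[ℝ] ℝ³ →L[ℝ] ℝ`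
set_option maxSynthPendingDepth 4

/-! ## The localised Green identity for `∂ₑ∂ₑq` -/

section Green

variable {r₀ r₁ : ℝ}

set_option maxHeartbeats 400000 in
/-- **`D²q(x)(e,e) = ∫ Γ₀(z) ∂ₑ∂ₑ(Δq)(x − z) dz + ∫ ∂ₑλ(z) ∂ₑq(x − z) dz`** for `q ∈ C⁴(ℝ³)`,
`0 < r₀ < r₁` (the localised Green identity `∫ Γ₀ Δφ = φ(0) − ∫ λ φ`,
`integral_newtonNear_mul_laplacian`, for `φ = ∂ₑ∂ₑq(x − ·)`, with `Δ∂ₑ∂ₑ = ∂ₑ∂ₑΔ` and one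
integration by parts in the smooth term). No decay of `q` is needed. [cite: GilbargTrudinger2001, (2.17)] -/
theorem fderiv2_apply_eq_newton_green {q : EuclideanSpace ℝ (Fin 3) → ℝ} (hq : ContDiff ℝ 4 q)
    (h₀ : 0 < r₀) (h₁ : r₀ < r₁) (x e : EuclideanSpace ℝ (Fin 3)) :
    fderiv ℝ (fderiv ℝ q) x e e =
      (∫ z, newtonNear r₀ r₁ z * fderiv ℝ (fun y => fderiv ℝ (Δ q) y e) (x - z) e) +
        ∫ z, fderiv ℝ (newtonFarLaplacian r₀ r₁) z e * fderiv ℝ q (x - z) e := by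
  have hq3 : ContDiff ℝ (3 + 1) q := by exact_mod_cast hq
  have hq1 : ContDiff ℝ (1 + 1) q := hq.of_le (by norm_num)
  have hP1 : ContDiff ℝ 3 (partialDeriv e q) := contDiff_partialDeriv hq3 e
  have hP1' : ContDiff ℝ (2 + 1) (partialDeriv e q) := by exact_mod_cast hP1
  have hh₂ : ContDiff ℝ 2 (partialDeriv e (partialDeriv e q)) := contDiff_partialDeriv hP1' e
  have hφ : ContDiff ℝ 2 fun z => partialDeriv e (partialDeriv e q) (x - z) :=
    hh₂.comp (contDiff_const.sub contDiff_id)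
  have key := integral_newtonNear_mul_laplacian h₀ h₁ hφ
  -- `φ 0 = D²q(x)(e,e)`
  have hD : DifferentiableAt ℝ (fderiv ℝ q) x :=
    ((hq.fderiv_right (m := 3) (by norm_num)).differentiable (by norm_num)) x
  have hφ0 : partialDeriv e (partialDeriv e q) (x - 0) = fderiv ℝ (fderiv ℝ q) x e e := by
    rw [sub_zero]
    exact fderiv_apply_const_apply hD e e
  -- `Δφ(z) = ∂ₑ∂ₑ(Δq)(x − z)`
  have hΔ : ∀ z, (Δ fun z => partialDeriv e (partialDeriv e q) (x - z)) z =
      fderiv ℝ (fun y => fderiv ℝ (Δ q) y e) (x - z) e := by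
    intro z
    rw [laplacian_comp_const_sub, laplacian_partialDeriv_partialDeriv hq]
    rfl
  -- the smooth term, one integration by parts
  have hlam : ∫ z, newtonFarLaplacian r₀ r₁ z * partialDeriv e (partialDeriv e q) (x - z) =
      ∫ z, fderiv ℝ (newtonFarLaplacian r₀ r₁) z e * fderiv ℝ q (x - z) e := by
    have h := integral_fderiv_mul_comp_sub (contDiff_newtonFarLaplacian h₀ h₁ (n := 1))
      (hasCompactSupport_newtonFarLaplacian h₀.le h₁) (contDiff_partialDeriv hq1 e) x e
    calc ∫ z, newtonFarLaplacian r₀ r₁ z * partialDeriv e (partialDeriv e q) (x - z)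
        = ∫ z, newtonFarLaplacian r₀ r₁ z * fderiv ℝ (partialDeriv e q) (x - z) e := rfl
      _ = ∫ z, fderiv ℝ (newtonFarLaplacian r₀ r₁) z e * partialDeriv e q (x - z) := h.symm
      _ = _ := rfl
  rw [hφ0] at key
  have key' : ∫ z, newtonNear r₀ r₁ z * fderiv ℝ (fun y => fderiv ℝ (Δ q) y e) (x - z) e =
      fderiv ℝ (fderiv ℝ q) x e e -
        ∫ z, newtonFarLaplacian r₀ r₁ z * partialDeriv e (partialDeriv e q) (x - z) := by
    rw [← key]
    exact integral_congr_ae (Eventually.of_forall fun z => by dsimp only; rw [hΔ z])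
  rw [key', hlam]
  ring

set_option maxHeartbeats 400000 in
/-- **The smooth remainder is `O(B/R)`**: with `λ = λ^{R/2·1, R/2·2}` and `‖∇q‖ ≤ B`,
`|∫ ∂ₑλ(z) ∂ₑq(x − z) dz| ≤ 16 M_λ |B₁| · B / R` (`‖Dλ‖ ≤ (R/2)⁻⁴ M_λ` by scaling, `λ`
supported in `|z| ≤ R`, `|B̄_R| = R³|B₁|`). [folklore] -/
theorem abs_integral_fderiv_newtonFarLaplacian_mul_le {R : ℝ} (hR : 0 < R) {Ml : ℝ}
    (hMl : ∀ w, ‖fderiv ℝ (newtonFarLaplacian (1 : ℝ) 2) w‖ ≤ Ml)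
    {q : EuclideanSpace ℝ (Fin 3) → ℝ} {B : ℝ} (hB : ∀ y, ‖fderiv ℝ q y‖ ≤ B)
    (x : EuclideanSpace ℝ (Fin 3)) {e : EuclideanSpace ℝ (Fin 3)} (he : ‖e‖ = 1) :
    |∫ z, fderiv ℝ (newtonFarLaplacian (R / 2 * 1) (R / 2 * 2)) z e * fderiv ℝ q (x - z) e| ≤
      16 * Ml * (volume (ball (0 : EuclideanSpace ℝ (Fin 3)) 1)).toReal * B / R := by
  have hc : 0 < R / 2 := by positivity
  have h₀ : (0 : ℝ) ≤ R / 2 * 1 := by linarith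
  have h₁ : R / 2 * 1 < R / 2 * 2 := by linarith
  have hB0 : 0 ≤ B := (norm_nonneg _).trans (hB 0)
  have hMl0 : 0 ≤ Ml := (norm_nonneg _).trans (hMl 0)
  set v₁ : ℝ := (volume (ball (0 : EuclideanSpace ℝ (Fin 3)) 1)).toReal with hv₁
  -- `‖Dλ(z)‖ ≤ 16 Ml / R⁴`, and `Dλ = 0` off the closed ball of radius `R`
  have e4 : (R / 2)⁻¹ ^ 4 * Ml = 16 * Ml / R ^ 4 := by field_simp; ring
  have hDl : ∀ z, ‖fderiv ℝ (newtonFarLaplacian (R / 2 * 1) (R / 2 * 2)) z‖ ≤ 16 * Ml / R ^ 4 := by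
    intro z
    rw [← e4, fderiv_newtonFarLaplacian_scale hc 1 2 z, norm_smul, norm_pow, norm_inv,
      Real.norm_eq_abs, abs_of_pos hc]
    exact mul_le_mul_of_nonneg_left (hMl _) (by positivity)
  have hDl0 : ∀ z : EuclideanSpace ℝ (Fin 3), R < ‖z‖ →
      fderiv ℝ (newtonFarLaplacian (R / 2 * 1) (R / 2 * 2)) z = 0 := by
    intro z hz
    have hev : newtonFarLaplacian (R / 2 * 1) (R / 2 * 2) =ᶠ[𝓝 z] fun _ => 0 := by
      filter_upwards [(isOpen_lt continuous_const continuous_norm).mem_nhds hz] with w hw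
      exact newtonFarLaplacian_eq_zero_of_gt h₀ h₁ (by linarith [show R < ‖w‖ from hw])
    rw [hev.fderiv_eq, fderiv_const_apply]
  -- pointwise bound by an indicator
  have hpt : ∀ z, |fderiv ℝ (newtonFarLaplacian (R / 2 * 1) (R / 2 * 2)) z e * fderiv ℝ q (x - z) e| ≤
      (closedBall (0 : EuclideanSpace ℝ (Fin 3)) R).indicator (fun _ => 16 * Ml / R ^ 4 * B) z := by
    intro z
    by_cases hz : z ∈ closedBall (0 : EuclideanSpace ℝ (Fin 3)) R
    · rw [indicator_of_mem hz, abs_mul]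
      refine mul_le_mul ?_ ?_ (abs_nonneg _) (by positivity)
      · rw [← Real.norm_eq_abs]
        calc ‖fderiv ℝ (newtonFarLaplacian (R / 2 * 1) (R / 2 * 2)) z e‖
            ≤ ‖fderiv ℝ (newtonFarLaplacian (R / 2 * 1) (R / 2 * 2)) z‖ * ‖e‖ :=
              ContinuousLinearMap.le_opNorm _ _
          _ ≤ 16 * Ml / R ^ 4 := by rw [he, mul_one]; exact hDl z
      · rw [← Real.norm_eq_abs]
        calc ‖fderiv ℝ q (x - z) e‖ ≤ ‖fderiv ℝ q (x - z)‖ * ‖e‖ := ContinuousLinearMap.le_opNorm _ _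
          _ ≤ B := by rw [he, mul_one]; exact hB _
    · rw [indicator_of_notMem hz]
      rw [mem_closedBall_zero_iff, not_le] at hz
      rw [hDl0 z hz, _root_.zero_apply, zero_mul, abs_zero]
  have hind : Integrable ((closedBall (0 : EuclideanSpace ℝ (Fin 3)) R).indicator
      fun _ => 16 * Ml / R ^ 4 * B) :=
    (integrableOn_const (hs := measure_closedBall_lt_top.ne)).integrable_indicator
      measurableSet_closedBall
  have hvR : (volume (closedBall (0 : EuclideanSpace ℝ (Fin 3)) R)).toReal = R ^ 3 * v₁ := by
    rw [Measure.addHaar_closedBall _ _ hR.le, finrank_euclideanSpace_fin, ENNReal.toReal_mul,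
      ENNReal.toReal_ofReal (by positivity), hv₁]
  calc |∫ z, fderiv ℝ (newtonFarLaplacian (R / 2 * 1) (R / 2 * 2)) z e * fderiv ℝ q (x - z) e|
      ≤ ∫ z, |fderiv ℝ (newtonFarLaplacian (R / 2 * 1) (R / 2 * 2)) z e * fderiv ℝ q (x - z) e| :=
        abs_integral_le_integral_abs
    _ ≤ ∫ z, (closedBall (0 : EuclideanSpace ℝ (Fin 3)) R).indicator
          (fun _ => 16 * Ml / R ^ 4 * B) z :=
        integral_mono_of_nonneg (Eventually.of_forall fun z => abs_nonneg _) hind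
          (Eventually.of_forall hpt)
    _ = 16 * Ml / R ^ 4 * B * (R ^ 3 * v₁) := by
        rw [integral_indicator_const _ measurableSet_closedBall, smul_eq_mul, measureReal_def, hvR]
        ring
    _ = 16 * Ml * v₁ * B / R := by field_simp

end Green

/-! ## The sharp-ball tomography for bounded smooth fields -/

section Tomography

set_option maxHeartbeats 400000 in
/-- **The truncated quadrupole transform on the sharp ball, decomposed** (`R > 0`, `‖e‖ = 1`,
`G ∈ C¹` bounded with bounded gradient): with `Γ₀ = newtonNear (R/2·1) (R/2·2)`,
`Γ∞ = newtonFar (R/2·1) (R/2·2)`,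
`∫_{|z|<R} D²Γ(z)(e,e)(G(x−z) − G(x)) dz
   = ∫ D²Γ₀(z)(e,e)(G(x−z) − G(x)) dz + ∫_{|z|<R} D²Γ∞(z)(e,e) G(x−z) dz − G(x)/3`
(`D²Γ = D²Γ₀ + D²Γ∞` off the origin; `D²Γ₀` vanishes for `|z| ≥ R`; the trace term
`∫_{|z|≤R} D²Γ∞(e,e) = 1/3`). [cite: GilbargTrudinger2001, Lemma 4.2 (4.9)] -/
theorem setIntegral_ball_hess_newtonKernel_mul_sub_eq {R : ℝ} (hR : 0 < R)
    {G : EuclideanSpace ℝ (Fin 3) → ℝ} (hG : ContDiff ℝ 1 G) {S L : ℝ}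
    (hS : ∀ y, ‖G y‖ ≤ S) (hL : ∀ y, ‖fderiv ℝ G y‖ ≤ L)
    (x : EuclideanSpace ℝ (Fin 3)) {e : EuclideanSpace ℝ (Fin 3)} (he : ‖e‖ = 1) :
    ∫ z in ball (0 : EuclideanSpace ℝ (Fin 3)) R,
        fderiv ℝ (fderiv ℝ newtonKernel) z e e * (G (x - z) - G x) =
      (∫ z, fderiv ℝ (fderiv ℝ (newtonNear (R / 2 * 1) (R / 2 * 2))) z e e * (G (x - z) - G x)) +
        (∫ z in ball (0 : EuclideanSpace ℝ (Fin 3)) R,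
          fderiv ℝ (fderiv ℝ (newtonFar (R / 2 * 1) (R / 2 * 2))) z e e * G (x - z)) -
        G x / 3 := by
  have h₀ : (0 : ℝ) < R / 2 * 1 := by linarith
  have h₁ : R / 2 * 1 < R / 2 * 2 := by linarith
  have hR2 : R / 2 * 2 = R := by ring
  -- a.e. splitting of the kernel on the ball
  have hsplit : ∀ᵐ z ∂((volume : Measure (EuclideanSpace ℝ (Fin 3))).restrict (ball 0 R)),
      fderiv ℝ (fderiv ℝ newtonKernel) z e e * (G (x - z) - G x) =
        fderiv ℝ (fderiv ℝ (newtonNear (R / 2 * 1) (R / 2 * 2))) z e e * (G (x - z) - G x) +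
          (fderiv ℝ (fderiv ℝ (newtonFar (R / 2 * 1) (R / 2 * 2))) z e e * G (x - z) -
            fderiv ℝ (fderiv ℝ (newtonFar (R / 2 * 1) (R / 2 * 2))) z e e * G x) := by
    have hae : ∀ᵐ z ∂(volume : Measure (EuclideanSpace ℝ (Fin 3))), z ≠ (0 : EuclideanSpace ℝ (Fin 3)) := by
      rw [ae_iff]; simp
    filter_upwards [ae_restrict_of_ae hae] with z hz
    rw [fderiv2_newtonKernel_eq_add h₀ h₁ hz]
    simp only [_root_.add_apply]
    ring
  -- integrability
  have iNear : Integrable fun z =>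
      fderiv ℝ (fderiv ℝ (newtonNear (R / 2 * 1) (R / 2 * 2))) z e e * (G (x - z) - G x) :=
    integrable_hess_newtonNear_mul_sub h₀ h₁ hG hS hL x e
  have hFar : ContDiff ℝ 2 (newtonFar (R / 2 * 1) (R / 2 * 2)) := contDiff_newtonFar h₀ h₁
  have hKc : Continuous fun z => fderiv ℝ (fderiv ℝ (newtonFar (R / 2 * 1) (R / 2 * 2))) z e e :=
    ((((hFar.fderiv_right (m := 1) le_rfl).continuous_fderiv one_ne_zero).clm_apply
      continuous_const).clm_apply continuous_const)
  have hGc : Continuous G := hG.continuous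
  have iFar1 : IntegrableOn (fun z =>
      fderiv ℝ (fderiv ℝ (newtonFar (R / 2 * 1) (R / 2 * 2))) z e e * G (x - z)) (ball 0 R) :=
    ((hKc.mul (hGc.comp (continuous_const.sub continuous_id))).continuousOn.integrableOn_compact
      (isCompact_closedBall 0 R)).mono_set ball_subset_closedBall
  have iFar2 : IntegrableOn (fun z =>
      fderiv ℝ (fderiv ℝ (newtonFar (R / 2 * 1) (R / 2 * 2))) z e e * G x) (ball 0 R) :=
    ((hKc.mul continuous_const).continuousOn.integrableOn_compact
      (isCompact_closedBall 0 R)).mono_set ball_subset_closedBall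
  have iFar12 : IntegrableOn (fun z =>
      fderiv ℝ (fderiv ℝ (newtonFar (R / 2 * 1) (R / 2 * 2))) z e e * G (x - z) -
        fderiv ℝ (fderiv ℝ (newtonFar (R / 2 * 1) (R / 2 * 2))) z e e * G x) (ball 0 R) :=
    iFar1.sub iFar2
  rw [integral_congr_ae hsplit, integral_add iNear.integrableOn iFar12, integral_sub iFar1 iFar2]
  -- the near term lives on the ball
  have hnear : ∫ z in ball (0 : EuclideanSpace ℝ (Fin 3)) R,
      fderiv ℝ (fderiv ℝ (newtonNear (R / 2 * 1) (R / 2 * 2))) z e e * (G (x - z) - G x) =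
      ∫ z, fderiv ℝ (fderiv ℝ (newtonNear (R / 2 * 1) (R / 2 * 2))) z e e * (G (x - z) - G x) := by
    refine setIntegral_eq_integral_of_forall_compl_eq_zero fun z hz => ?_
    have hz' : R / 2 * 2 ≤ ‖z‖ := by
      rw [hR2]; rw [mem_ball_zero_iff, not_lt] at hz; exact hz
    have h0 := newtonNearHess_eq_zero_of_le h₀ h₁ e e hz'
    rw [newtonNearHess] at h0
    rw [h0, zero_mul]
  -- the trace term
  have hball : closedBall (0 : EuclideanSpace ℝ (Fin 3)) R = closedBall 0 (R / 2 * 2) := by rw [hR2]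
  have hae : (ball (0 : EuclideanSpace ℝ (Fin 3)) R : Set (EuclideanSpace ℝ (Fin 3))) =ᵐ[volume]
      closedBall (0 : EuclideanSpace ℝ (Fin 3)) R := by
    refine ae_eq_set.2 ⟨?_, ?_⟩
    · rw [sdiff_eq_empty.2 ball_subset_closedBall, measure_empty]
    · rw [closedBall_sdiff_ball, Measure.addHaar_sphere]
  have htrace : ∫ z in ball (0 : EuclideanSpace ℝ (Fin 3)) R,
      fderiv ℝ (fderiv ℝ (newtonFar (R / 2 * 1) (R / 2 * 2))) z e e * G x = G x / 3 := by
    rw [integral_mul_const, setIntegral_congr_set hae, hball,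
      setIntegral_fderiv2_newtonFar_apply_self h₀ h₁ e, he]
    ring
  rw [hnear, htrace]
  ring

set_option maxHeartbeats 400000 in
/-- **Polar-quadrupole tomography of the Hessian, for bounded smooth fields.** There is an
absolute constant `c₀ ≥ 0` such that: for every divergence-free `u ∈ C⁴(ℝ³; ℝ³)` with
`|u| ≤ M`, `‖∇u‖ ≤ M₁` and `G = div((u·∇)u)` bounded with bounded gradient, every `q ∈ C⁴(ℝ³)`
with `Δq = −G` and `‖∇q‖ ≤ B`, every `R > 0`, `x` and unit `e`,
`|D²q(x)(e,e) + G(x)/3 + ∫_{|z|<R} D²Γ(z)(e,e)(G(x−z) − G(x)) dz| ≤ c₀ (M M₁/R + M²/R² + B/R)`.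
Proof: `D²q(x)(e,e) = −∫Γ₀ ∂ₑ∂ₑG(x−z) + ∫∂ₑλ ∂ₑq(x−z)` (Green), `∫Γ₀∂ₑ∂ₑG(x−z) =
∫D²Γ₀(e,e)(G(x−z)−G(x))` (Gilbarg–Trudinger), the sharp-ball decomposition, the far-shell
bound and `|∫∂ₑλ ∂ₑq| ≲ B/R`. [cite: GilbargTrudinger2001, (2.17) and Lemma 4.2 (4.9)–(4.10)] -/
theorem exists_hessian_tomography_bound :
    ∃ c₀ : ℝ, 0 ≤ c₀ ∧ ∀ (u : EuclideanSpace ℝ (Fin 3) → EuclideanSpace ℝ (Fin 3))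
      (q : EuclideanSpace ℝ (Fin 3) → ℝ) (M M₁ B S L R : ℝ) (x e : EuclideanSpace ℝ (Fin 3)),
      ContDiff ℝ 4 u → VectorCalculus.IsDivFree u → (∀ y, ‖u y‖ ≤ M) →
      (∀ y, ‖fderiv ℝ u y‖ ≤ M₁) → ContDiff ℝ 4 q →
      (∀ y, Laplacian.laplacian q y = -VectorCalculus.divergence (convect u u) y) →
      (∀ y, ‖fderiv ℝ q y‖ ≤ B) →
      (∀ y, ‖VectorCalculus.divergence (convect u u) y‖ ≤ S) →
      (∀ y, ‖fderiv ℝ (VectorCalculus.divergence (convect u u)) y‖ ≤ L) →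
      0 < R → ‖e‖ = 1 →
      |fderiv ℝ (fderiv ℝ q) x e e + VectorCalculus.divergence (convect u u) x / 3 +
          ∫ z in Metric.ball (0 : EuclideanSpace ℝ (Fin 3)) R, fderiv ℝ (fderiv ℝ newtonKernel) z e e *
            (VectorCalculus.divergence (convect u u) (x - z) -
              VectorCalculus.divergence (convect u u) x)| ≤
        c₀ * (M * M₁ / R + M ^ 2 / R ^ 2 + B / R) := by
  obtain ⟨cJ, hcJ0, hcJ⟩ := exists_farShell_bound
  obtain ⟨Ml, hMl0, hMl⟩ :=
    exists_bound_fderiv_newtonFarLaplacian (r₀ := (1 : ℝ)) (r₁ := 2) one_pos one_lt_two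
  set v₁ : ℝ := (volume (ball (0 : EuclideanSpace ℝ (Fin 3)) 1)).toReal with hv₁
  have hv₁0 : 0 ≤ v₁ := ENNReal.toReal_nonneg
  refine ⟨cJ + 16 * Ml * v₁, by positivity, ?_⟩
  intro u q M M₁ B S L R x e hu hdiv hM hM₁ hq hΔq hB hS hL hR he
  have hM0 : 0 ≤ M := (norm_nonneg _).trans (hM 0)
  have hM₁0 : 0 ≤ M₁ := (norm_nonneg _).trans (hM₁ 0)
  have hB0 : 0 ≤ B := (norm_nonneg _).trans (hB 0)
  set G : EuclideanSpace ℝ (Fin 3) → ℝ := VectorCalculus.divergence (convect u u) with hGdef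
  have h₀ : (0 : ℝ) < R / 2 * 1 := by linarith
  have h₁ : R / 2 * 1 < R / 2 * 2 := by linarith
  have hu4 : ContDiff ℝ (3 + 1) u := by exact_mod_cast hu
  have hW3 : ContDiff ℝ (2 + 1) (convect u u) := by exact_mod_cast contDiff_convect_self hu4
  have hG2 : ContDiff ℝ 2 G := contDiff_divergence hW3
  -- (1) the localised Green identity
  have hE1 := fderiv2_apply_eq_newton_green hq h₀ h₁ x e
  -- `∂ₑ∂ₑ(Δq) = −∂ₑ∂ₑG`
  have hΔfun : Δ q = fun y => -G y := funext hΔq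
  have hpdd : ∀ w, fderiv ℝ (fun y => fderiv ℝ (Δ q) y e) w e =
      -fderiv ℝ (fun y => fderiv ℝ G y e) w e := by
    intro w
    have h2 : (fun y => fderiv ℝ (Δ q) y e) = fun y => -(fderiv ℝ G y e) := by
      funext y
      rw [hΔfun, fderiv_fun_neg]
      rfl
    rw [h2, fderiv_fun_neg]
    rfl
  have hInt1 : ∫ z, newtonNear (R / 2 * 1) (R / 2 * 2) z *
      fderiv ℝ (fun y => fderiv ℝ (Δ q) y e) (x - z) e =
      -∫ z, newtonNear (R / 2 * 1) (R / 2 * 2) z * fderiv ℝ (fun y => fderiv ℝ G y e) (x - z) e := by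
    rw [← integral_neg]
    refine integral_congr_ae (Eventually.of_forall fun z => ?_)
    dsimp only
    rw [hpdd]
    ring
  -- (2) Gilbarg–Trudinger, (3) the sharp-ball decomposition
  have hE2 := integral_newtonNear_mul_pdd_eq h₀ h₁ hG2 hS hL x e
  have hE3 := setIntegral_ball_hess_newtonKernel_mul_sub_eq hR (hG2.of_le one_le_two) hS hL x he
  -- (4) the far shell and the smooth remainder
  have hJ := hcJ u M M₁ R x e (hu.of_le (by norm_num)) hdiv hM hM₁ hR he
  have hEl := abs_integral_fderiv_newtonFarLaplacian_mul_le hR hMl hB x he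
  -- assemble
  have hident : fderiv ℝ (fderiv ℝ q) x e e + G x / 3 +
      (∫ z in ball (0 : EuclideanSpace ℝ (Fin 3)) R,
        fderiv ℝ (fderiv ℝ newtonKernel) z e e * (G (x - z) - G x)) =
      (∫ z, fderiv ℝ (newtonFarLaplacian (R / 2 * 1) (R / 2 * 2)) z e * fderiv ℝ q (x - z) e) +
        ∫ z in ball (0 : EuclideanSpace ℝ (Fin 3)) R,
          fderiv ℝ (fderiv ℝ (newtonFar (R / 2 * 1) (R / 2 * 2))) z e e * G (x - z) := by
    rw [hE3, hE1, hInt1, hE2]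
    ring
  rw [hident]
  have ha : 0 ≤ M * M₁ / R + M ^ 2 / R ^ 2 := by positivity
  have hb : 0 ≤ B / R := by positivity
  calc |(∫ z, fderiv ℝ (newtonFarLaplacian (R / 2 * 1) (R / 2 * 2)) z e * fderiv ℝ q (x - z) e) +
        ∫ z in ball (0 : EuclideanSpace ℝ (Fin 3)) R,
          fderiv ℝ (fderiv ℝ (newtonFar (R / 2 * 1) (R / 2 * 2))) z e e * G (x - z)|
      ≤ |∫ z, fderiv ℝ (newtonFarLaplacian (R / 2 * 1) (R / 2 * 2)) z e * fderiv ℝ q (x - z) e| +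
        |∫ z in ball (0 : EuclideanSpace ℝ (Fin 3)) R,
          fderiv ℝ (fderiv ℝ (newtonFar (R / 2 * 1) (R / 2 * 2))) z e e * G (x - z)| := abs_add_le _ _
    _ ≤ 16 * Ml * v₁ * B / R + cJ * (M * M₁ / R + M ^ 2 / R ^ 2) := add_le_add hEl hJ
    _ = (16 * Ml * v₁) * (B / R) + cJ * (M * M₁ / R + M ^ 2 / R ^ 2) := by ring
    _ ≤ (cJ + 16 * Ml * v₁) * (M * M₁ / R + M ^ 2 / R ^ 2 + B / R) := by
        nlinarith [mul_nonneg hcJ0 hb, mul_nonneg (mul_nonneg (mul_nonneg (by norm_num : (0:ℝ) ≤ 16) hMl0) hv₁0) ha]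

end Tomography

end Summit.NavierStokesRegularity.NavierStokesRegularity.Theorems

end
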